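import Summits.CriticalPhenomena.CardyFormulaZ2.Theorems.CardyBoundaryCoulombGasBoundaryDefectGaussianRStubRealisabilityPart43

/-!
# Stub `stub_realisability` of line `rainbow-monomials-in-excursion-kernels` — Part 44:
# Lemma V — IV: flat insertion points — the straight run through a footprint (`strip_of_active`)
# (crux `BoundaryDefectGaussianR`, stmt-CriticalPhenomena-14132)

The FLATNESS hypothesis of the stubs (`V` is a discrete half-plane within distance `R` of every
insertion point) read along the wall: with `(p, k)` the insertion point's exterior dart, the lattice
point `p + aτ + bn` (`τ = dir (k+1)`, `n = dir k`, `a² + b² ≤ R²`) is in `V` iff `b ≤ 0`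
(`flat_mem`, registered as `s13_flatMem`); hence the darts of the cycle at offsets `-4 … R - 2` from
the insertion point's dart run straight, `(p + jτ, k)` (`run_dart`: forward by `dsucc`, backward by
the injectivity of `dsucc` and the closure of the cycle under predecessors, Part 41). Combined with
the footprint lemma of Part 41 (an active dart — one changing level or wiredness — sits at most
`sinkLegs - 1` darts after an insertion point) and `R = sinkLegs + 4`: **`strip_of_active`** — around
an active dart the six darts at offsets `-3 … +2`, each with the dart before and after it, form the
straight configuration of Part 43's `strip_pair`, with the two rows behind the wall in `V` and the
two rows in front outside. (Radius `sinkLegs + 3` would leave the dart four steps before an active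
sink dart uncertified; any fixed radius is implied eventually by the stubs' `r/δ → ∞`.) Also here:
`chart8_of_chart3`, the chart hypothesis in the `7 × 7` sup-norm form of `s16_eventually_chart`
implies the `√8`-charts of Part 42.
-/

namespace Summit.CriticalPhenomena.CardyFormulaZ2.Cruxes.BoundaryDefectGaussianR.RainbowMonomialsInExcursionKernels

open Literature.Probability.LatticeModels Literature.Probability.LatticeModels.CollarLegModel

/-- The four elements of `Fin 4` (file-local copy). [folklore] -/
private theorem fin4_cases (i : Fin 4) : i = 0 ∨ i = 1 ∨ i = 2 ∨ i = 3 := by fin_cases i <;> simp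

/-- Cycle darts are exterior darts (file-local form of Part 13's `cycle_getElem_exterior`, for an
exterior base dart instead of an admissible datum). [folklore] -/
private theorem cycle_exterior {V : Finset (ℤ × ℤ)} {d₀ : Dart} (hv₀ : d₀.1 ∈ V) (ht₀ : dartTip d₀ ∉ V)
    {t : ℕ} (ht : t < (cycle V d₀).length) :
    ((cycle V d₀)[t]).1 ∈ V ∧ ((cycle V d₀)[t]).1 + dir ((cycle V d₀)[t]).2 ∉ V := by
  rw [se_cycle_getElem]
  exact (s3_dsucc_iterate V t).1 d₀ hv₀ ht₀

section Flat

variable {V : Finset (ℤ × ℤ)} {p : ℤ × ℤ} {k : Fin 4} {R : ℤ} {d : ℤ × ℤ}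

/-- **A flat insertion point in coordinates along the wall.** If `V` is a half-plane within distance
`R ≥ 1` of `p` and `p + dir k ∉ V`, then the inward normal is `-dir k`, and the lattice point
`p + a τ + b n` (`τ = dir (k+1)` along the wall, `n = dir k` outward) with `a² + b² ≤ R²` lies in
`V` iff `b ≤ 0`. [folklore] -/
theorem flat_mem (hd : d = (1, 0) ∨ d = (-1, 0) ∨ d = (0, 1) ∨ d = (0, -1))
    (hflat : ∀ v : ℤ × ℤ, (v.1 - p.1) ^ 2 + (v.2 - p.2) ^ 2 ≤ R ^ 2 →
      (v ∈ V ↔ 0 ≤ (v.1 - p.1) * d.1 + (v.2 - p.2) * d.2))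
    (hout : p + dir k ∉ V) (hR : 1 ≤ R) (a b : ℤ) (hab : a ^ 2 + b ^ 2 ≤ R ^ 2) :
    p + a • dir (k + 1) + b • dir k ∈ V ↔ b ≤ 0 := by
  have hR1 : 1 ≤ |R| := le_abs.mpr (Or.inl hR)
  have h1 := hflat (p + dir k) (by rcases fin4_cases k with rfl | rfl | rfl | rfl <;> simp <;> exact hR1)
  have h2 := hflat (p + a • dir (k + 1) + b • dir k)
    (by rcases fin4_cases k with rfl | rfl | rfl | rfl <;> simp <;> nlinarith [hab])
  obtain ⟨p1, p2⟩ := p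
  rcases fin4_cases k with rfl | rfl | rfl | rfl <;> rcases hd with rfl | rfl | rfl | rfl <;>
    simp at h1 h2 hout ⊢ <;> first | exact absurd h1 hout | exact h2


/-- Going straight: the rewriting rule for `dsucc` along a wall. [folklore] -/
theorem dsucc_straight_rule {v : ℤ × ℤ} (h1 : v + dir (k + 1) ∈ V) (h2 : v + dir (k + 1) + dir k ∉ V) :
    dsucc V (v, k) = (v + dir (k + 1), k) := by
  simp [dsucc, h1, h2]

/-- Index bookkeeping: successor indices modulo `P` are injective on `[0, P)` (file-local; cf.
`IsLatticeReflection.mod_succ_inj`). [folklore] -/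
private theorem succ_mod_inj {P u v : ℕ} (hu : u < P) (hv : v < P) (h : (u + 1) % P = (v + 1) % P) : u = v := by
  rcases Nat.lt_or_ge (u + 1) P with hu1 | hu1 <;> rcases Nat.lt_or_ge (v + 1) P with hv1 | hv1
  · rw [Nat.mod_eq_of_lt hu1, Nat.mod_eq_of_lt hv1] at h; omega
  · rw [Nat.mod_eq_of_lt hu1, show v + 1 = P by omega, Nat.mod_self] at h; omega
  · rw [Nat.mod_eq_of_lt hv1, show u + 1 = P by omega, Nat.mod_self] at h; omega
  · omega

/-- Index bookkeeping: the offset indices `(s + 4P - 4 + e) % P` are consecutive. [folklore] -/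
theorem idx_succ {P s : ℕ} (e : ℕ) : ((s + 4 * P - 4 + e) % P + 1) % P = (s + 4 * P - 4 + (e + 1)) % P := by
  rw [Nat.mod_add_mod, show s + 4 * P - 4 + e + 1 = s + 4 * P - 4 + (e + 1) by omega]

/-- Index bookkeeping: offset `4` is the start index itself. [folklore] -/
theorem idx_four {P s : ℕ} (hs : s < P) : (s + 4 * P - 4 + 4) % P = s := by
  rw [show s + 4 * P - 4 + 4 = s + P * 4 by omega, Nat.add_mul_mod_self_left, Nat.mod_eq_of_lt hs]

/-- Equal indices carry equal darts (dependent rewriting helper). [folklore] -/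
theorem getElem_cycle_congr {d₀ : Dart} {i j : ℕ} (hi : i < (cycle V d₀).length) (hj : j < (cycle V d₀).length)
    (h : i = j) : (cycle V d₀)[i] = (cycle V d₀)[j] := by
  subst h; rfl

variable {d₀ : Dart} (hv₀ : d₀.1 ∈ V) (ht₀ : dartTip d₀ ∉ V)
include hv₀ ht₀

/-- **The straight run of darts through a flat insertion point.** If dart `s` of the cycle is
`(p, k)` and `V` is a half-plane within distance `R ≥ 5` of `p`, then for every offset `e` with
`(e - 3)² + 1 ≤ R²` the dart at index `(s + 4P - 4 + e) % P` (offset `e - 4` from `s`, the four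
darts before `s` included) is `(p + (e - 4) τ, k)`, `τ = dir (k+1)`. [folklore] -/
theorem run_dart {s : ℕ} (hs : s < (cycle V d₀).length) (hpk : (cycle V d₀)[s] = (p, k))
    (hd : d = (1, 0) ∨ d = (-1, 0) ∨ d = (0, 1) ∨ d = (0, -1))
    (hflat : ∀ v : ℤ × ℤ, (v.1 - p.1) ^ 2 + (v.2 - p.2) ^ 2 ≤ R ^ 2 →
      (v ∈ V ↔ 0 ≤ (v.1 - p.1) * d.1 + (v.2 - p.2) * d.2))
    (hR : 5 ≤ R) :
    ∀ e : ℕ, ((e : ℤ) - 3) ^ 2 + 1 ≤ R ^ 2 →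
      (cycle V d₀)[(s + 4 * (cycle V d₀).length - 4 + e) % (cycle V d₀).length]'(Nat.mod_lt _ (by omega)) =
        (p + ((e : ℤ) - 4) • dir (k + 1), k) := by
  set P := (cycle V d₀).length with hPdef
  have hP : 0 < P := by omega
  have hout : p + dir k ∉ V := by have := (cycle_exterior hv₀ ht₀ hs).2; rwa [hpk] at this
  have hm := flat_mem hd hflat hout (by omega)
  -- membership along the wall
  have hin : ∀ a : ℤ, a ^ 2 ≤ R ^ 2 → p + a • dir (k + 1) ∈ V := fun a ha =>
    mem_of_eq ((hm a 0 (by simpa using ha)).2 le_rfl) (by module)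
  have hno : ∀ a : ℤ, a ^ 2 + 1 ≤ R ^ 2 → p + a • dir (k + 1) + dir k ∉ V := fun a ha h =>
    absurd ((hm a 1 (by simpa using ha)).1 (mem_of_eq h (by module))) (by omega)
  -- the straight successor rule along the wall
  have hstep : ∀ a : ℤ, (a + 1) ^ 2 + 1 ≤ R ^ 2 →
      dsucc V (p + a • dir (k + 1), k) = (p + (a + 1) • dir (k + 1), k) := by
    intro a ha
    rw [dsucc_straight_rule (mem_of_eq (hin (a + 1) (by omega)) (by module)) (nmem_of_eq (hno (a + 1) ha) (by module))]
    congr 1; module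
  -- forward from offset 4
  have hfwd : ∀ e : ℕ, 4 ≤ e → ((e : ℤ) - 3) ^ 2 + 1 ≤ R ^ 2 →
      (cycle V d₀)[(s + 4 * P - 4 + e) % P]'(Nat.mod_lt _ hP) = (p + ((e : ℤ) - 4) • dir (k + 1), k) := by
    intro e he
    induction e, he using Nat.le_induction with
    | base =>
      intro _
      rw [getElem_cycle_congr (Nat.mod_lt _ hP) hs (idx_four hs), hpk]
      simp
    | succ e he ih =>
      intro hb
      have ih' := ih (by push_cast at hb ⊢; nlinarith)
      rw [← getElem_cycle_congr (Nat.mod_lt _ hP) (Nat.mod_lt _ hP) (idx_succ (s := s) e),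
        cycle_succ hv₀ ht₀ (Nat.mod_lt _ hP), ih', hstep _ (by push_cast at hb ⊢; nlinarith)]
      congr 2; push_cast; ring
  -- backward from offset 4
  have hbwd : ∀ j : ℕ, j ≤ 4 →
      (cycle V d₀)[(s + 4 * P - 4 + (4 - j)) % P]'(Nat.mod_lt _ hP) = (p + (((4 - j : ℕ) : ℤ) - 4) • dir (k + 1), k) := by
    intro j hj
    induction j with
    | zero => exact hfwd 4 le_rfl (by push_cast; nlinarith [hR])
    | succ j ih =>
      have ih' := ih (by omega)
      have hR2 : (25 : ℤ) ≤ R ^ 2 := by nlinarith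
      -- the candidate predecessor dart is exterior and its successor is the dart at offset `4 - j`
      set a : ℤ := (((4 - (j + 1) : ℕ) : ℤ) - 4) with ha
      have ha' : (((4 - j : ℕ) : ℤ) - 4) = a + 1 := by rw [ha]; omega
      have ha2 : a = -(j : ℤ) - 1 := by rw [ha]; omega
      have hj0 : (0 : ℤ) ≤ j ∧ (j : ℤ) ≤ 3 := by constructor <;> omega
      have hab : a ^ 2 ≤ 16 ∧ (a + 1) ^ 2 ≤ 9 := by rw [ha2]; constructor <;> nlinarith [hj0.1, hj0.2]
      have hev : (p + a • dir (k + 1), k).1 ∈ V := hin a (by omega)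
      have het : dartTip (p + a • dir (k + 1), k) ∉ V := by rw [dartTip_mk]; exact hno a (by omega)
      have hsucc : dsucc V (p + a • dir (k + 1), k) = (cycle V d₀)[(s + 4 * P - 4 + (4 - j)) % P]'(Nat.mod_lt _ hP) := by
        rw [ih', ha', hstep a (by omega)]
      obtain ⟨s', hs', hs'1, hds'⟩ := cycle_pred_of_dsucc hv₀ ht₀ hev het (Nat.mod_lt _ hP) hsucc
      have hidx : ((s + 4 * P - 4 + (4 - (j + 1))) % P + 1) % P = (s + 4 * P - 4 + (4 - j)) % P := by
        rw [idx_succ, show 4 - (j + 1) + 1 = 4 - j by omega]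
      have := succ_mod_inj hs' (Nat.mod_lt _ hP) (hs'1.trans hidx.symm)
      subst this
      exact hds'
  intro e hb
  rcases Nat.lt_or_ge e 4 with he | he
  · have := hbwd (4 - e) (by omega)
    rw [show 4 - (4 - e) = e by omega] at this
    exact this
  · exact hfwd e he hb

end Flat


/-! ### The chart hypothesis in the form of `s16_eventually_chart` -/

section ChartConversion

/-- **From `7 × 7` sup-norm charts to `√8`-charts.** The chart hypothesis in the form produced by
`s16_eventually_chart` for lattice approximations of rectilinear Jordan domains (every exterior dart
`(u, k)` of `V` has a half-plane / quadrant / three-quarter-plane chart on the `7 × 7` block around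
`u`, written with `dir K`, `dir (K + 1)` and two integer levels) implies the `√8`-chart hypothesis of
Lemma V (Parts 42, 45, 46): the apex is `c₁ • dir K + c₂ • dir (K+1)`, the unit vector `dir K` or
`dir (K + 1)`. [folklore] -/
theorem chart8_of_chart3 {V : Finset (ℤ × ℤ)}
    (hchart : ∀ u ∈ V, ∀ k : Fin 4, u + dir k ∉ V → ∃ (K : Fin 4) (c₁ c₂ : ℤ),
      (∀ v : ℤ × ℤ, |v.1 - u.1| ≤ 3 → |v.2 - u.2| ≤ 3 → (v ∈ V ↔ c₂ ≤ v.1 * (dir (K + 1)).1 + v.2 * (dir (K + 1)).2)) ∨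
      (∀ v : ℤ × ℤ, |v.1 - u.1| ≤ 3 → |v.2 - u.2| ≤ 3 →
        (v ∈ V ↔ c₁ ≤ v.1 * (dir K).1 + v.2 * (dir K).2 ∧ c₂ ≤ v.1 * (dir (K + 1)).1 + v.2 * (dir (K + 1)).2)) ∨
      (∀ v : ℤ × ℤ, |v.1 - u.1| ≤ 3 → |v.2 - u.2| ≤ 3 →
        (v ∈ V ↔ c₂ ≤ v.1 * (dir (K + 1)).1 + v.2 * (dir (K + 1)).2 ∨ v.1 * (dir K).1 + v.2 * (dir K).2 ≤ c₁))) :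
    ∀ x ∈ V, (∃ y : ℤ × ℤ, y ∉ V ∧ (y.1 - x.1) ^ 2 + (y.2 - x.2) ^ 2 = 1) →
      ∃ a d : ℤ × ℤ, (d = (1, 0) ∨ d = (-1, 0) ∨ d = (0, 1) ∨ d = (0, -1)) ∧
      ((∀ v : ℤ × ℤ, (v.1 - x.1) ^ 2 + (v.2 - x.2) ^ 2 ≤ 8 →
          (v ∈ V ↔ 0 ≤ (v.1 - a.1) * d.1 + (v.2 - a.2) * d.2)) ∨
       (∀ v : ℤ × ℤ, (v.1 - x.1) ^ 2 + (v.2 - x.2) ^ 2 ≤ 8 →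
          (v ∈ V ↔ 0 ≤ (v.1 - a.1) * d.1 + (v.2 - a.2) * d.2 ∧ 0 ≤ (v.2 - a.2) * d.1 - (v.1 - a.1) * d.2)) ∨
       (∀ v : ℤ × ℤ, (v.1 - x.1) ^ 2 + (v.2 - x.2) ^ 2 ≤ 8 →
          (v ∈ V ↔ 0 ≤ (v.1 - a.1) * d.1 + (v.2 - a.2) * d.2 ∨ 0 ≤ (v.2 - a.2) * d.1 - (v.1 - a.1) * d.2))) := by
  intro x hx ⟨y, hyV, hy⟩
  -- the outside neighbour is `x + dir k`
  have hsq : (y.1 - x.1) ^ 2 ≤ 1 ∧ (y.2 - x.2) ^ 2 ≤ 1 := by constructor <;> nlinarith [sq_nonneg (y.1 - x.1), sq_nonneg (y.2 - x.2)]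
  have hb : -1 ≤ y.1 - x.1 ∧ y.1 - x.1 ≤ 1 ∧ -1 ≤ y.2 - x.2 ∧ y.2 - x.2 ≤ 1 := by
    refine ⟨?_, ?_, ?_, ?_⟩ <;> nlinarith [hsq.1, hsq.2]
  obtain ⟨k, hk⟩ : ∃ k : Fin 4, y = x + dir k := by
    obtain ⟨x1, x2⟩ := x; obtain ⟨y1, y2⟩ := y
    simp only at hy hb
    obtain ⟨a, ha⟩ : ∃ a, a = y1 - x1 := ⟨_, rfl⟩
    obtain ⟨b, hb'⟩ : ∃ b, b = y2 - x2 := ⟨_, rfl⟩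
    rw [← ha, ← hb'] at hy hb
    have ha3 : a = -1 ∨ a = 0 ∨ a = 1 := by omega
    have hb3 : b = -1 ∨ b = 0 ∨ b = 1 := by omega
    rcases ha3 with rfl | rfl | rfl <;> rcases hb3 with rfl | rfl | rfl <;> norm_num at hy
    · exact ⟨2, by rw [dir_two]; ext <;> simp <;> omega⟩
    · exact ⟨3, by rw [dir_three]; ext <;> simp <;> omega⟩
    · exact ⟨1, by rw [dir_one]; ext <;> simp <;> omega⟩
    · exact ⟨0, by rw [dir_zero]; ext <;> simp <;> omega⟩
  subst hk
  -- the radius: `|v - x|² ≤ 8` lies in the `7 × 7` block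
  have hrad : ∀ v : ℤ × ℤ, (v.1 - x.1) ^ 2 + (v.2 - x.2) ^ 2 ≤ 8 → |v.1 - x.1| ≤ 3 ∧ |v.2 - x.2| ≤ 3 := by
    intro v hv
    constructor <;> rw [abs_le] <;> constructor <;> nlinarith [sq_nonneg (v.1 - x.1), sq_nonneg (v.2 - x.2)]
  obtain ⟨K, c₁, c₂, hK⟩ := hchart x hx k hyV
  obtain ⟨x1, x2⟩ := x
  rcases hK with hK | hK | hK
  · refine ⟨c₂ • dir (K + 1), dir (K + 1), ?_, Or.inl fun v hv => ?_⟩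
    · rcases fin4_cases K with rfl | rfl | rfl | rfl <;> simp
    · rw [hK v (hrad v hv).1 (hrad v hv).2]
      rcases fin4_cases K with rfl | rfl | rfl | rfl <;> simp <;> omega
  · refine ⟨c₁ • dir K + c₂ • dir (K + 1), dir K, ?_, Or.inr (Or.inl fun v hv => ?_)⟩
    · rcases fin4_cases K with rfl | rfl | rfl | rfl <;> simp
    · rw [hK v (hrad v hv).1 (hrad v hv).2]
      rcases fin4_cases K with rfl | rfl | rfl | rfl <;> simp <;> omega
  · refine ⟨c₁ • dir K + c₂ • dir (K + 1), dir (K + 1), ?_, Or.inr (Or.inr fun v hv => ?_)⟩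
    · rcases fin4_cases K with rfl | rfl | rfl | rfl <;> simp
    · rw [hK v (hrad v hv).1 (hrad v hv).2]
      rcases fin4_cases K with rfl | rfl | rfl | rfl <;> simp <;> omega

end ChartConversion

/-! ### The strip around an active dart of an admissible walk with flat insertion points -/

section Strip

variable (ι : LegInsertionData) (V : Finset (ℤ × ℤ)) {d₀ : Dart} (hadm : ι.IsAdmissible V)
  (h0 : outDart V ι.sink = some d₀) {st : ℕ → WalkState}
  (hst : ∀ t, st t = List.foldl (fun s d => s.step (ι.startAt V d)) ι.init ((cycle V d₀).take t))
  (hFL : ∀ x ∈ insert ι.sink ι.source, ∃ d : ℤ × ℤ, (d = (1, 0) ∨ d = (-1, 0) ∨ d = (0, 1) ∨ d = (0, -1)) ∧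
    ∀ v : ℤ × ℤ, (v.1 - x.1) ^ 2 + (v.2 - x.2) ^ 2 ≤ ((ι.sinkLegs : ℤ) + 4) ^ 2 →
      (v ∈ V ↔ 0 ≤ (v.1 - x.1) * d.1 + (v.2 - x.2) * d.2))

include hadm h0 hst hFL in
/-- **The straight strip around an active dart.** If dart `t` of an admissible walk changes the
level or the wiredness, it lies in the footprint of an insertion point `p`, at most `sinkLegs - 1`
darts after it; if the insertion points are flat to distance `sinkLegs + 4`, then the darts at
offsets `-3 … +2` from `t` (indices `(t + 4P - 4 + e) % P`, `1 ≤ e ≤ 6`), together with the dart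
before and after each, run straight along the wall through `p`, and the two lattice rows behind the
wall are in `V`, the two rows in front of it are not — the data of `strip_pair`. [folklore] -/
theorem strip_of_active {t : ℕ} (ht : t < (cycle V d₀).length)
    (hne : ¬ ((st (t + 1)).level = (st t).level ∧ (st (t + 1)).wired = (st t).wired))
    {e : ℕ} (he1 : 1 ≤ e) (he6 : e ≤ 6) :
    ∃ (z : ℤ × ℤ) (k : Fin 4),
      (cycle V d₀)[(t + 4 * (cycle V d₀).length - 4 + e) % (cycle V d₀).length]'(Nat.mod_lt _ (by omega)) = (z, k) ∧
      (cycle V d₀)[(t + 4 * (cycle V d₀).length - 4 + (e - 1)) % (cycle V d₀).length]'(Nat.mod_lt _ (by omega)) =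
        (z - dir (k + 1), k) ∧
      (cycle V d₀)[((t + 4 * (cycle V d₀).length - 4 + e) % (cycle V d₀).length + 1) % (cycle V d₀).length]'
        (Nat.mod_lt _ (by omega)) = (z + dir (k + 1), k) ∧
      z ∈ V ∧ z - dir (k + 1) ∈ V ∧ z + dir (k + 1) ∈ V ∧ z - dir k ∈ V ∧
      z + dir k ∉ V ∧ z - dir (k + 1) + dir k ∉ V ∧ z + dir (k + 1) + dir k ∉ V ∧
      z + dir k + dir k ∉ V ∧ z - dir (k + 1) + dir k + dir k ∉ V ∧ z + dir (k + 1) + dir k + dir k ∉ V ∧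
      z + dir (k + 1) + dir (k + 1) ∈ V ∧ z + dir (k + 1) - dir k ∈ V ∧
      z + dir (k + 1) + dir (k + 1) + dir k ∉ V ∧ z + dir (k + 1) + dir (k + 1) + dir k + dir k ∉ V := by
  obtain ⟨hv₀, ht₀⟩ := sinkDart_exterior ι V hadm h0
  set P := (cycle V d₀).length with hPdef
  have hP : 0 < P := by omega
  -- the footprint containing `t`
  obtain ⟨s, hs, Ls, σ, hsome, hbd⟩ := active_footprint ι V hadm hst ht hne
  have hsP : s < P := by omega
  rw [getElem!_pos (cycle V d₀) s hsP] at hsome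
  obtain ⟨-, hLs, hins, -⟩ := startAt_some ι V hadm hsome
  obtain ⟨d, hd, hflat⟩ := hFL _ hins
  -- the insertion point and its outward direction
  obtain ⟨⟨p, k⟩, hpk⟩ : ∃ q : Dart, (cycle V d₀)[s] = q := ⟨_, rfl⟩
  simp only [hpk] at hflat
  obtain ⟨j0, rfl⟩ : ∃ j0, t = s + j0 := ⟨t - s, by omega⟩
  have hj0 : (j0 : ℤ) + 1 ≤ ι.sinkLegs := by
    have : j0 + 1 ≤ Ls := by omega
    exact_mod_cast this.trans hLs
  set L : ℤ := (ι.sinkLegs : ℤ) with hL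
  have hL1 : 1 ≤ L := by rw [hL]; exact_mod_cast sinkLegs_pos ι V hadm
  have hR : (5 : ℤ) ≤ L + 4 := by omega
  have hout : p + dir k ∉ V := by have := (cycle_exterior hv₀ ht₀ hsP).2; rwa [hpk] at this
  have hm := flat_mem hd hflat hout (by omega)
  have hrun := run_dart hv₀ ht₀ hsP hpk hd hflat hR
  -- bounds
  have hbound : ∀ a b : ℤ, -4 ≤ a → a ≤ L + 3 → -1 ≤ b → b ≤ 2 → a ^ 2 + b ^ 2 ≤ (L + 4) ^ 2 := by
    intro a b h1 h2 h3 h4; nlinarith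
  have IN : ∀ a' b : ℤ, -1 ≤ a' → a' ≤ 2 → -1 ≤ b → b ≤ 0 →
      p + ((j0 : ℤ) + e - 4 + a') • dir (k + 1) + b • dir k ∈ V := fun a' b h1 h2 h3 h4 =>
    (hm _ _ (hbound _ _ (by omega) (by omega) h3 (by omega))).2 h4
  have OUT : ∀ a' b : ℤ, -1 ≤ a' → a' ≤ 2 → 1 ≤ b → b ≤ 2 →
      p + ((j0 : ℤ) + e - 4 + a') • dir (k + 1) + b • dir k ∉ V := fun a' b h1 h2 h3 h4 h =>
    absurd ((hm _ _ (hbound _ _ (by omega) (by omega) (by omega) h4)).1 h) (by omega)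
  -- darts
  have hidx : ∀ e' : ℕ, (s + j0 + 4 * P - 4 + e') % P = (s + 4 * P - 4 + (j0 + e')) % P := fun e' => by
    congr 1; omega
  have hdart : ∀ e' : ℕ, e' ≤ 7 → (cycle V d₀)[(s + j0 + 4 * P - 4 + e') % P]'(Nat.mod_lt _ hP) =
      (p + ((j0 : ℤ) + e' - 4) • dir (k + 1), k) := by
    intro e' he'
    rw [getElem_cycle_congr (Nat.mod_lt _ hP) (Nat.mod_lt _ hP) (hidx e'), hrun (j0 + e') (by push_cast; nlinarith)]
    push_cast; ring_nf
  refine ⟨p + ((j0 : ℤ) + e - 4) • dir (k + 1), k, hdart e (by omega), ?_, ?_, ?_⟩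
  · rw [hdart (e - 1) (by omega)]; congr 1; push_cast [Nat.cast_sub he1]; module
  · rw [getElem_cycle_congr (Nat.mod_lt _ hP) (Nat.mod_lt _ hP) (idx_succ (s := s + j0) e), hdart (e + 1) (by omega)]
    congr 1; push_cast; module
  refine ⟨mem_of_eq (IN 0 0 (by norm_num) (by norm_num) (by norm_num) le_rfl) (by module),
    mem_of_eq (IN (-1) 0 le_rfl (by norm_num) (by norm_num) le_rfl) (by module),
    mem_of_eq (IN 1 0 (by norm_num) (by norm_num) (by norm_num) le_rfl) (by module),
    mem_of_eq (IN 0 (-1) (by norm_num) (by norm_num) le_rfl (by norm_num)) (by module),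
    nmem_of_eq (OUT 0 1 (by norm_num) (by norm_num) le_rfl (by norm_num)) (by module),
    nmem_of_eq (OUT (-1) 1 le_rfl (by norm_num) le_rfl (by norm_num)) (by module),
    nmem_of_eq (OUT 1 1 (by norm_num) (by norm_num) le_rfl (by norm_num)) (by module),
    nmem_of_eq (OUT 0 2 (by norm_num) (by norm_num) (by norm_num) le_rfl) (by module),
    nmem_of_eq (OUT (-1) 2 le_rfl (by norm_num) (by norm_num) le_rfl) (by module),
    nmem_of_eq (OUT 1 2 (by norm_num) (by norm_num) (by norm_num) le_rfl) (by module),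
    mem_of_eq (IN 2 0 (by norm_num) le_rfl (by norm_num) le_rfl) (by module),
    mem_of_eq (IN 1 (-1) (by norm_num) (by norm_num) le_rfl (by norm_num)) (by module),
    nmem_of_eq (OUT 2 1 (by norm_num) le_rfl le_rfl (by norm_num)) (by module),
    nmem_of_eq (OUT 2 2 (by norm_num) le_rfl (by norm_num) le_rfl) (by module)⟩

end Strip

/-! ### Registered one-line form -/

/-- **Sub-goal `s13_flatMem`** (registered on stmt-CriticalPhenomena-14132): a flat insertion point
in coordinates along the wall — if `V` is a half-plane within distance `R ≥ 1` of `p` and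
`p + dir k ∉ V`, then `p + a • dir (k+1) + b • dir k ∈ V ↔ b ≤ 0` whenever `a² + b² ≤ R²`. [folklore] -/
theorem s13_flatMem : ∀ (V : Finset (ℤ × ℤ)) (p d : ℤ × ℤ) (k : Fin 4) (R : ℤ), (d = (1, 0) ∨ d = (-1, 0) ∨ d = (0, 1) ∨ d = (0, -1)) → (∀ v : ℤ × ℤ, (v.1 - p.1) ^ 2 + (v.2 - p.2) ^ 2 ≤ R ^ 2 → (v ∈ V ↔ 0 ≤ (v.1 - p.1) * d.1 + (v.2 - p.2) * d.2)) → p + Literature.Probability.LatticeModels.CollarLegModel.dir k ∉ V → 1 ≤ R → ∀ a b : ℤ, a ^ 2 + b ^ 2 ≤ R ^ 2 → (p + a • Literature.Probability.LatticeModels.CollarLegModel.dir (k + 1) + b • Literature.Probability.LatticeModels.CollarLegModel.dir k ∈ V ↔ b ≤ 0) :=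
  fun _ _ _ _ _ hd hflat hout hR a b hab => flat_mem hd hflat hout hR a b hab

end Summit.CriticalPhenomena.CardyFormulaZ2.Cruxes.BoundaryDefectGaussianR.RainbowMonomialsInExcursionKernels
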